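import Summits.QuantumFields.YangMills.Theorems.UnitScaleTiltProp7Growth142T3ChartELStat
import Summits.QuantumFields.YangMills.Theorems.UnitScaleTiltProp7Taylor3ActionUniform
import HarnessLib

/-!
# Route `UnitScaleTilt`, crux K1 child «MinimiserStabilityRegPr» (stmt-QuantumFields-19200) — THE α-P LANE SUPPLIER SHAPE FOR THE EX KNIT v3.0ˢ's LOCMIN_W:
# «scale-aware Taylor ∧ EL (stationarity form) ∧ HESS_W′ ∧ NORMAL_W ⟹ `A(W) ≤ A(e^{iD}W)` for every direction `D` of the slice» — ONE text serving E′ (R2-critical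
# background, `PV3ESigmaUniform`) and EX (E–L-critical chart point, ★★OWNER RULING №30 (3))

Cell `ym3-torus`, width seat `ym-ust-19200-w4` (gen 4; ★w2-19200 g4 (v3.0ˢ pen) 2026-08-28 11:36Z: «LOCMIN_W quantifies `D ∈ Tsl i W` with `D` Hermitian-traceless explicit
and every size inside the opaque `Tsl` … the α-P supplier instantiates `Tsl` and uses F3 freely»).  THEOREMS ONLY (0 `def`, 0 `sorry`).  YM₃ on T³ is a ladder rung (R3),
not the Clay problem; nothing here claims the stub, the crux, d = 4 or the mass gap.

WHAT IS PROVED (ns `…Theorems.Prop7LocMinOfSliceRows`).  ★★★ `wilsonAction4_le_expChart_of_sliceRows_stat` — at a configuration `W ∈ 𝔘_k(e)` satisfying the EX knit's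
E–L CLAUSE over `𝔅_k(V)` (stationarity along bondwise-differentiable fibre curves), for a set `T` of directions each carrying: Hermitian-traceless `D` with `‖D(b)‖ ≤ s`;
a curve `γ` through `W` with bond velocities `ξ` and a differentiable GAUGE LIFT into `𝔅_k(V)` (print's Σ_k through the (1.29)-normalised `u` of
[Balaban1985RegularSpaces] Thm 2); NORMAL_W `Σ_b‖iD(b) − ξ(b)‖ ≤ c_N·Σ‖D‖²` ((47)–(48)); HESS_W′ `κ·Σ‖D‖² ≤ Σ_p‖ℒ_p(D)‖²` ((116) on the slice) — and the smallness
`15552s² + 216·regThreshold(e) + e·(L^{K−n})⁻³·c_N ≤ κ∕4`: `A(W) ≤ A(e^{iD}W)` for every `D ∈ T`.  EL and Taylor are THEOREMS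
(`Prop7Growth142T3ChartELStat.abs_lin_chart_le_of_fibreEL_current`, `Prop7Taylor3Uniform.wilsonAction4_expChart_sub_lin_ge`); the `ℓ`-bookkeeping to `L`-only
constants is `PV3ESigmaUniform.scaled_smallness`.  This is LOCMIN_W of ✓`Prop7CminOfP6T3PdW` for any `Tsl i W ⊆ T`.

HONEST SCOPE.  Bookkeeping; the three rows are displayed, nothing of print asserted; `--supports stmt-QuantumFields-19200`, count-neutral.

References: T. Bałaban, CMP 102 (1985) 277–309 [Balaban1985Variational] ((2), (6) p.278, (47)–(48) pp.285–286, (116) p.295, (141)–(142) p.299); CMP 99 (1985) 75–102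
[Balaban1985RegularSpaces] ((1.28)–(1.31) pp.80–82, Thm 2 p.83).
-/

set_option autoImplicit false
noncomputable section

open scoped BigOperators Matrix.Norms.L2Operator Matrix Topology
open Filter

namespace Summit.QuantumFields.YangMills.Theorems.Prop7LocMinOfSliceRows

open Literature.MathematicalPhysics.QuantumFieldTheory.Balaban1983to89
open Literature.MathematicalPhysics.QuantumFieldTheory.Balaban1983to89.T3ContinuumYM3Torus
open Literature.MathematicalPhysics.QuantumFieldTheory.Balaban1983to89.T3UnitLawDensityEML (ℰp)
open Literature.MathematicalPhysics.QuantumFieldTheory.Balaban1983to89.T3ConstrainedMinimiser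
open Literature.MathematicalPhysics.QuantumFieldTheory.Balaban1983to89.T3Thm1Carrier
open Literature.MathematicalPhysics.QuantumFieldTheory.Balaban1983to89.T3PrintedRegularMinimiser
open Literature.MathematicalPhysics.QuantumFieldTheory.Balaban1983to89.T3RegularMinimiser
open Literature.MathematicalPhysics.QuantumFieldTheory.Balaban1983to89.T3SectALandauChart (emb15 pos_of_regPr)
open Summit.QuantumFields.YangMills.Theorems.Prop7TPrint (expHermField)
open Summit.QuantumFields.YangMills.Theorems.Prop7Taylor3Uniform (wilsonAction4_expChart_sub_lin_ge)
open Summit.QuantumFields.YangMills.Theorems.Prop7Growth142T3ChartELStat (abs_lin_chart_le_of_fibreEL_current)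

/-- ★★★ **LOCMIN_W FROM THE SLICE ROWS, STATIONARITY FORM.**  See the module docstring. [cite: Balaban1985Variational, (141)-(142) p.299, (47)-(48) pp.285-286, (116) p.295, (2), (6) p.278] -/
theorem wilsonAction4_le_expChart_of_sliceRows_stat (F : T3Family) {n K : ℕ} (h : n ≤ K) {e s cN κ : ℝ}
    (V : GaugeField (F.P n) 0 (Matrix.specialUnitaryGroup (Fin 2) ℂ)) {W : GaugeField (F.P K) 0 (Matrix.specialUnitaryGroup (Fin 2) ℂ)}
    (hEL : ∀ φ : ℝ → GaugeField (F.P K) 0 (Matrix.specialUnitaryGroup (Fin 2) ℂ), φ 0 = W → (∀ t, φ t ∈ fibre F ℰp n K h V) →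
      (∀ b : PBond (F.P K) 0, DifferentiableAt ℝ (fun t => ((φ t b : Matrix.specialUnitaryGroup (Fin 2) ℂ) : Matrix (Fin 2) (Fin 2) ℂ)) 0) →
        deriv (fun t => wilsonAction4 (φ t)) 0 = 0)
    (hreg : RegPr F n K e W) (T : Set (PBond (F.P K) 0 → Matrix (Fin 2) (Fin 2) ℂ))
    (hrows : ∀ D ∈ T, (∀ b : PBond (F.P K) 0, (D b).IsHermitian ∧ Matrix.trace (D b) = 0) ∧ (∀ b : PBond (F.P K) 0, ‖D b‖ ≤ s) ∧
      ∃ (γ : ℝ → GaugeField (F.P K) 0 (Matrix.specialUnitaryGroup (Fin 2) ℂ)) (ξ : PBond (F.P K) 0 → Matrix (Fin 2) (Fin 2) ℂ) (u : ℝ → GaugeTransf (F.P K) 0 (Matrix.specialUnitaryGroup (Fin 2) ℂ)),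
        γ 0 = W ∧ (∀ b : PBond (F.P K) 0, HasDerivAt (fun t : ℝ => (γ t b : Matrix (Fin 2) (Fin 2) ℂ) * star (W b : Matrix (Fin 2) (Fin 2) ℂ)) (ξ b) 0) ∧
        u 0 = (fun _ => 1) ∧ (∀ t, GaugeField.gaugeAct (u t) (γ t) ∈ fibre F ℰp n K h V) ∧
        (∀ b : PBond (F.P K) 0, DifferentiableAt ℝ (fun t => ((GaugeField.gaugeAct (u t) (γ t) b : Matrix.specialUnitaryGroup (Fin 2) ℂ) : Matrix (Fin 2) (Fin 2) ℂ)) 0) ∧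
        (∑ b : PBond (F.P K) 0, ‖Complex.I • D b - ξ b‖ ≤ cN * ∑ b : PBond (F.P K) 0, ‖D b‖ ^ 2) ∧
        κ * ∑ b : PBond (F.P K) 0, ‖D b‖ ^ 2 ≤ ∑ p : Plaq (F.P K) 0, ‖((Complex.I • D ⟨p.src, p.μ⟩) + ((W ⟨p.src, p.μ⟩ : Matrix (Fin 2) (Fin 2) ℂ) * (Complex.I • D ⟨p.src.shift p.μ, p.ν⟩) * star (W ⟨p.src, p.μ⟩ : Matrix (Fin 2) (Fin 2) ℂ))
            - (((W ⟨p.src, p.μ⟩ * W ⟨p.src.shift p.μ, p.ν⟩ * (W ⟨p.src.shift p.ν, p.μ⟩)⁻¹ : Matrix.specialUnitaryGroup (Fin 2) ℂ) : Matrix (Fin 2) (Fin 2) ℂ) * (Complex.I • D ⟨p.src.shift p.ν, p.μ⟩) * star ((W ⟨p.src, p.μ⟩ * W ⟨p.src.shift p.μ, p.ν⟩ * (W ⟨p.src.shift p.ν, p.μ⟩)⁻¹ : Matrix.specialUnitaryGroup (Fin 2) ℂ) : Matrix (Fin 2) (Fin 2) ℂ))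
            - (((GaugeField.plaqHol W p : Matrix.specialUnitaryGroup (Fin 2) ℂ) : Matrix (Fin 2) (Fin 2) ℂ) * (Complex.I • D ⟨p.src, p.ν⟩) * star ((GaugeField.plaqHol W p : Matrix.specialUnitaryGroup (Fin 2) ℂ) : Matrix (Fin 2) (Fin 2) ℂ)))‖ ^ 2)
    (hs4 : 4 * s ≤ 1)
    (hsmall : 15552 * s ^ 2 + 216 * regThreshold F n K e + e * (((F.L : ℝ) ^ (K - n)) ^ 3)⁻¹ * cN ≤ κ / 4) :
    ∀ D ∈ T, wilsonAction4 W ≤ wilsonAction4 (emb15 W (expHermField D)) := by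
  intro D hDT
  obtain ⟨hDh, hDs, γ, ξ, u, hγ0, hγξ, hu0, hufib, hudiff, hN, hq⟩ := hrows D hDT
  have he0 : 0 < e := pos_of_regPr F hreg
  have hthr0 : 0 ≤ regThreshold F n K e := by unfold regThreshold; positivity
  have ha : ∀ p : Plaq (F.P K) 0, ‖((GaugeField.plaqHol W p : Matrix.specialUnitaryGroup (Fin 2) ℂ) : Matrix (Fin 2) (Fin 2) ℂ) - 1‖ ≤ regThreshold F n K e := fun p => by
    have hp := hreg.1 p
    rw [SU2Mean.dist1_eq_norm] at hp
    exact hp.le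
  have hT := wilsonAction4_expChart_sub_lin_ge W D hDh hDs hs4 hthr0 ha (θ := 1 / 2) (by norm_num) (by norm_num)
  rw [show ((1 : ℝ) - 1 / 2) / 2 = 1 / 4 by norm_num, show (7776 : ℝ) * (1 / 2)⁻¹ = 15552 by norm_num] at hT
  have hELb := abs_lin_chart_le_of_fibreEL_current hEL hreg.2 D γ hγ0 ξ hγξ u hu0 hufib hudiff
  have hL1 : (1 : ℝ) ≤ (F.L : ℝ) := by have := F.hL.2; exact_mod_cast (by omega : 1 ≤ F.L)
  have hj0 : 0 ≤ e * (((F.L : ℝ) ^ (K - n)) ^ 3)⁻¹ := by positivity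
  have hS0 : 0 ≤ ∑ b : PBond (F.P K) 0, ‖D b‖ ^ 2 := Finset.sum_nonneg fun _ _ => sq_nonneg _
  have hEL' : |∑ p : Plaq (F.P K) 0, (1 / 2) * (((((GaugeField.plaqHol W p : Matrix.specialUnitaryGroup (Fin 2) ℂ) : Matrix (Fin 2) (Fin 2) ℂ) - 1)ᴴ * (((Complex.I • D ⟨p.src, p.μ⟩) + ((W ⟨p.src, p.μ⟩ : Matrix (Fin 2) (Fin 2) ℂ) * (Complex.I • D ⟨p.src.shift p.μ, p.ν⟩) * star (W ⟨p.src, p.μ⟩ : Matrix (Fin 2) (Fin 2) ℂ))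
            - (((W ⟨p.src, p.μ⟩ * W ⟨p.src.shift p.μ, p.ν⟩ * (W ⟨p.src.shift p.ν, p.μ⟩)⁻¹ : Matrix.specialUnitaryGroup (Fin 2) ℂ) : Matrix (Fin 2) (Fin 2) ℂ) * (Complex.I • D ⟨p.src.shift p.ν, p.μ⟩) * star ((W ⟨p.src, p.μ⟩ * W ⟨p.src.shift p.μ, p.ν⟩ * (W ⟨p.src.shift p.ν, p.μ⟩)⁻¹ : Matrix.specialUnitaryGroup (Fin 2) ℂ) : Matrix (Fin 2) (Fin 2) ℂ))
            - (((GaugeField.plaqHol W p : Matrix.specialUnitaryGroup (Fin 2) ℂ) : Matrix (Fin 2) (Fin 2) ℂ) * (Complex.I • D ⟨p.src, p.ν⟩) * star ((GaugeField.plaqHol W p : Matrix.specialUnitaryGroup (Fin 2) ℂ) : Matrix (Fin 2) (Fin 2) ℂ))) * ((GaugeField.plaqHol W p : Matrix.specialUnitaryGroup (Fin 2) ℂ) : Matrix (Fin 2) (Fin 2) ℂ))).trace).re|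
      ≤ e * (((F.L : ℝ) ^ (K - n)) ^ 3)⁻¹ * (cN * ∑ b : PBond (F.P K) 0, ‖D b‖ ^ 2) :=
    hELb.trans (mul_le_mul_of_nonneg_left hN hj0)
  have habs := (abs_le.mp hEL').1
  have h3 : 0 ≤ (κ / 4 - 15552 * s ^ 2 - 216 * regThreshold F n K e - e * (((F.L : ℝ) ^ (K - n)) ^ 3)⁻¹ * cN)
      * ∑ b : PBond (F.P K) 0, ‖D b‖ ^ 2 := mul_nonneg (by linarith) hS0
  nlinarith [hT, habs, hq, h3]

end Summit.QuantumFields.YangMills.Theorems.Prop7LocMinOfSliceRows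

end
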